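import Mathlib
import HarnessLib
import Summits.HubbardSuperconductivity.HubbardSuperconductivity.Theorems.KLProgrammeKLRegimeEngineScaleZeroKernelNormsWtPackage
import Summits.HubbardSuperconductivity.HubbardSuperconductivity.Theorems.KLProgrammeKLRegimeEngineScaleZeroE4PackageDoors
import Summits.HubbardSuperconductivity.HubbardSuperconductivity.Theorems.KLProgrammeKLRegimeEngineKernelNormsWt4

/-!
# KL programme — K3 ENGINE child (`KLRegimeEngineV17F2`, stmt-HubbardSuperconductivity-20437), stub (b) `stub_engine_step_norms`, level `j = 0`:
# (E1-W)₀ UNDER THE DOORS and the CARVED WEIGHTED LINE `KernelNormsWt4 … (klWtBudget P Q U 0) … K 0` at every admissible frame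

Cell `gate-hubbard-kl`, seat p3 (g9).  Stub (b) of the engine-flow skeleton concludes, at every inductive scale `n ≥ 1`,
`∀ j ≤ n, KernelNormsLevels … K_n j ∧ KernelNormsWt4 L M (klWtBudget P Q U j) β U μ K_n j` at the flow frame `K_n`; its level `j = 0` is ONE
ultraviolet step read through the scale-`0` sector analysis at the frame `K_n` — the (E1-W)₀ profile my g8 files produce for ANY admissible
frame (`…ScaleZeroKernelNormsWt`, `…ScaleZeroKernelNormsWtPackage`).  This file finishes that supply line:

* §1 **`kernelNormsWt_zero_of_doors`** — `kernelNormsWt_zero_of_bounds` (p3 g8) with its majorants DISCHARGED BY NAME through p4 g9's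
  `…ScaleZeroE4PackageDoors` §1 (`abar_le_klE4Abar`, `kKbar_le`, `thetaW_smallness_of_doors`, `spaceMoment_klAnisoFamily_zero_le_of_doors`): under
  `c ≤ klEngC₃3 P R ⊓ klE4C₃ R`, `U ≤ klEngU₀3 P R c ⊓ klE4U₀ R` (so under the registration thresholds `klEngC₃6`, `klEngU₀6/7/8/9` by one `le_trans`),
  for every admissible frame `K` and a time-moment witness `C_T` (p4 g8's `exists_timeMomentConst_klAnisoFamily_zero`),
  `KernelNormsWt L M N β U μ K 0` for every budget `N` with `N 2 ≥ 2t²(e⁵(klE4KapF R·|U| + 2(c/log 4)·klE4Mom R) + 4e⁹κ₀²|U|)`,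
  `N (2p) ≥ 2^p·4e⁹κ₀⁴κ₀^{−2p}·t^{2p}·(16e⁹κ₀²·klE4Abar R·|U|)^{p−2}·|U|` (`p ≥ 2`), `N odd ≥ 0`, where **`t := 2·klIsoT + C_T + 8(klE4X0 + 1)`**, `κ₀ = √(2(7+6047))`;
* §2 the pure-real budget comparison `wtBudget_dominates_biGraded` and **`kernelNormsWt4_zero_klWtBudget_of_le_CE`**: for EVERY engine package `Q` with
  **`32·e⁹·t²·klE4Abar R ≤ Q.CE`** the carved line `KernelNormsWt4 L M (klWtBudget P Q U 0) β U μ K 0` (degree `2`, whose honest size is the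
  counterterm's first moment, is carved by token #8; odd degrees vanish; degrees `2p ≥ 4`: `16e⁹t⁴|U| ≤ (32e⁹t²Ā)²·Klam·|U|` at `p = 2` and
  `LHS = (64e⁹Ā²)⁻¹·(32e⁹t²Ā)^p·|U|^{p−1}` at `p ≥ 3`, using `Ā = klE4Abar R ≥ 1`, `P.Klam ≥ 1`);
* §3 the registration-threshold corollary `kernelNormsWt4_zero_klWtBudget_klEng6_of_le_CE` (`klEngC₃6`, `klEngU₀6`) and the `∃ T ≥ 0` form
  **`exists_kernelNormsWt4_zero_klWtBudget_klEng6`** with `T` INDEPENDENT of `P`, `R`, `Q` (the `Classical.choose` input of a `Q`-side package raise,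
  #7 pattern — KL STATUS 2026-08-27 k3c2-p1 g4 «Wt-KEY@j=0» / p3 g9 13:0xZ).

HONEST SCOPE.  The CE-threshold `32e⁹t²·klE4Abar R` is a closed NON-NUMERIC term (`klIsoT`, the `C_T` witness, `klE4X0 ∋ klCutSqB5, klAngWA`,
`klE4Abar ∋ klCutoffX5` are choice constants): the j = 0 weighted line is delivered for every `Q` dominating it, NOT for `klEngQ6 P R` (no order
relation between the two terms is provable).  Everything is proved; no definitions, no named facts, no sorry.  Nothing asserts superconductivity.
-/

noncomputable section

namespace Summit.HubbardSuperconductivity.HubbardSuperconductivity.Theorems.EngineV8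

set_option linter.dupNamespace false -- summit = problem name (single-conjunct summit), D-0017

open Real Finset Complex Literature.MathematicalPhysics.QuantumLattice Literature.Probability.LatticeModels
open Literature.MathematicalPhysics.QuantumLattice.GrassmannAlgebra
open Summit.HubbardSuperconductivity.HubbardSuperconductivity.Theorems.KLRegimeSplit
open Summit.HubbardSuperconductivity.HubbardSuperconductivity.Theorems.DispersionFlow
open Summit.HubbardSuperconductivity.HubbardSuperconductivity.Theorems.KLProgrammeLegKernels
open Summit.HubbardSuperconductivity.HubbardSuperconductivity.Theorems.ScaleZeroDecay
open scoped ComplexConjugate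

/-! ## §1 (E1-W)₀ under the doors -/

/-- **(E1-W)₀ UNDER THE DOORS** — `KernelNormsWt L M N β U μ K 0` at every admissible frame `K`, for every budget `N` dominating the explicit degree
profile, under `c ≤ klEngC₃3 P R`, `c ≤ klE4C₃ R`, `U ≤ klEngU₀3 P R c`, `U ≤ klE4U₀ R`, given a time-moment witness `C_T` (p4 g8's
`exists_timeMomentConst_klAnisoFamily_zero`): `N 2 ≥ 2t²·(e⁵·(klE4KapF R·|U| + 2(c/log 4)·klE4Mom R) + 4e⁹κ₀²|U|)`,
`N (2p) ≥ 2^p·4e⁹κ₀⁴·κ₀^{−2p}·t^{2p}·(16e⁹κ₀²·klE4Abar R·|U|)^{p−2}·|U|` (`p ≥ 2`), `N odd ≥ 0`, `t = 2·klIsoT + C_T + 8(klE4X0 + 1)`. -/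
theorem kernelNormsWt_zero_of_doors {C_T : ℝ} (hCT0 : 0 ≤ C_T)
    (hCT : ∀ (L M : ℕ) [NeZero L] [NeZero M] (R : RenConsts) (U : ℝ) (N : ℕ) (μ : ℝ) (K : TrigPolyC4v),
      FrameOK R U N μ K → (∀ j, 0 ≤ R.Gfr j) → μ ∈ klWindowC → 16 / 15 * (R.Gfr 0 * |U|) ≤ 1 / 50 → (2 : ℝ) ^ 15 ≤ L →
      ∀ β : ℝ, klBetaMin ≤ β → β ≤ M → klE0 * β ≤ Real.pi * (2 * M - 13) →
      ∀ (ω : Fin (sectorCount 0)) (c : Fin 2),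
        1 / (|β| * (L : ℝ) ^ 2) *
            ∑ dw : TorusSite 1 (2 * (2 * M)) × TorusSite 2 L,
              (β / (2 * (2 * M) : ℕ) * cyclicDist (2 * (2 * M)) (dw.1 0) 0) *
                ‖∑ k : FreqMomentum L M, klAnisoFamily L M β μ K klE0 0 ω k *
                  (if c = 0 then torusChar (fun _ : Fin 1 => ((k.1 : ℕ) : ZMod (2 * (2 * M)))) dw.1 * torusChar k.2 dw.2
                    else conj (torusChar (fun _ : Fin 1 => ((k.1 : ℕ) : ZMod (2 * (2 * M)))) dw.1 * torusChar k.2 dw.2))‖ ≤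
          C_T * (M / β))
    (P : SplitConsts) (R : RenConsts) (c : ℝ) (hP : P.WF) (hR : R.WF2) (hc : 0 < c) (hc₃ : c ≤ klEngC₃3 P R) (hcD : c ≤ klE4C₃ R)
    (μ : ℝ) (hμ : μ ∈ klWindowC) (U : ℝ) (hU : 0 < U) (hU₀ : U ≤ klEngU₀3 P R c) (hUD : U ≤ klE4U₀ R) (β : ℝ) (hβ : klBetaMin ≤ β)
    (hβc : β ≤ Real.exp (c / U ^ 2)) (K : TrigPolyC4v) (hK : FrameOK R U (nScales β) μ K) (L M : ℕ) [NeZero L] [NeZero M]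
    (hL : klEngL₃ β U ≤ L) (hM : klEngM₃ β U L ≤ M)
    (N : ℕ → ℝ) (hNodd : ∀ m, Odd m → 0 ≤ N m)
    (hN2 : 2 * (2 * klIsoT + C_T + 8 * (klE4X0 + 1)) ^ 2 *
        (Real.exp 1 ^ 5 * (klE4KapF R * |U| + 2 * (c / Real.log 4) * klE4Mom R) +
          4 * Real.exp 1 ^ 9 * Real.sqrt (2 * (7 + 6047)) ^ 2 * |U|) ≤ N 2)
    (hNp : ∀ p, 2 ≤ p → 2 ^ p * (4 * Real.exp 1 ^ 9 * Real.sqrt (2 * (7 + 6047)) ^ 4 * (Real.sqrt (2 * (7 + 6047)))⁻¹ ^ (2 * p) *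
        (2 * klIsoT + C_T + 8 * (klE4X0 + 1)) ^ (2 * p) *
          (16 * Real.exp 1 ^ 9 * Real.sqrt (2 * (7 + 6047)) ^ 2 * klE4Abar R * |U|) ^ (p - 2) * |U|) ≤ N (2 * p)) :
    KernelNormsWt L M N β U μ K 0 := by
  have hRwf : R.WF := hR.wf
  have hU1 : |U| ≤ 1 := abs_le_one_of_le_klEngU₀3 hU hU₀
  have hκU : 16 / 15 * (R.Gfr 0 * |U|) ≤ 1 / 50 := gfr0_abs_mul_le_of_le_klEngU₀3 hU hU₀
  obtain ⟨hL15, -, -, -, hβ3M, -⟩ := scaleZero_regime_sizes hβ hL hM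
  have hN := nScales_succ_mul_sq_le (U := U) hc.le hβ hβc
  have hhalf := div_log_four_le_half_of_door hcD
  obtain ⟨hθ1, hθ2⟩ := thetaW_smallness_of_doors (R := R) hU hUD hc.le hcD
  have hX0 : 0 ≤ klE4X0 := uvSpaceMomentConst_nonneg _ _ _
  exact kernelNormsWt_zero_of_bounds hCT0 hCT (X := 8 * (klE4X0 + 1)) (by positivity) P R c hP hR hc hc₃ μ hμ U hU hU₀ β hβ hβc K hK L M
    hL hM one_le_klCutoffX5 norm_iteratedDeriv_salmhoferCutoff_le_klCutoffX5
    (Abar := klE4Abar R) (abar_le_klE4Abar hRwf hU1 (hN.trans hhalf))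
    (kKbar := klE4KapF R * |U| + 2 * (c / Real.log 4) * klE4Mom R) (kKbar_le hRwf hN) hθ1 hθ2
    (fun ω c' => spaceMoment_klAnisoFamily_zero_le_of_doors hK hRwf hU hU1 hUD hc.le hcD hμ hκU hL15 hβ hβc hβ3M ω c') N hNodd hN2 hNp

/-! ## §2 The carved weighted line at the (E1-W) budget `klWtBudget P Q U 0` -/

/-- **The budget comparison (pure real numbers)**: with `1 ≤ e`, `0 < κ`, `1 ≤ A`, `0 ≤ u`, `1 ≤ Klam` and `32·e⁹·t²·A ≤ CE` (any real `t`),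
the bi-graded scale-`0` bound of degree `2(p'+2)` is dominated by `CE^{p'+2}·(Klam·u)^{p'+1}`:
`2^{p'+2}·(4e⁹κ⁴·κ⁻¹^{2(p'+2)}·t^{2(p'+2)}·(16e⁹κ²·A·u)^{p'}·u) ≤ CE^{p'+2}·(Klam·u)^{p'+1}`. -/
theorem wtBudget_dominates_biGraded {e κ t A u CE Klam : ℝ} (he : 1 ≤ e) (hκ : 0 < κ) (hA : 1 ≤ A) (hu : 0 ≤ u)
    (hKlam : 1 ≤ Klam) (hCE : 32 * e ^ 9 * t ^ 2 * A ≤ CE) (p' : ℕ) :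
    2 ^ (p' + 2) * (4 * e ^ 9 * κ ^ 4 * κ⁻¹ ^ (2 * (p' + 2)) * t ^ (2 * (p' + 2)) * (16 * e ^ 9 * κ ^ 2 * A * u) ^ p' * u) ≤
      CE ^ (p' + 2) * (Klam * u) ^ (p' + 1) := by
  have he0 : 0 < e := lt_of_lt_of_le one_pos he
  have hA0 : 0 < A := lt_of_lt_of_le one_pos hA
  have hκne : κ ≠ 0 := hκ.ne'
  set X : ℝ := 32 * e ^ 9 * t ^ 2 * A with hX
  have hX0 : 0 ≤ X := by rw [hX]; positivity
  have hCE0 : 0 ≤ CE := hX0.trans hCE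
  -- the left-hand side in closed form
  have hLHS : 2 ^ (p' + 2) * (4 * e ^ 9 * κ ^ 4 * κ⁻¹ ^ (2 * (p' + 2)) * t ^ (2 * (p' + 2)) * (16 * e ^ 9 * κ ^ 2 * A * u) ^ p' * u) =
      16 * e ^ 9 * t ^ 4 * X ^ p' * u ^ (p' + 1) := by
    have hk : κ ^ 4 * κ⁻¹ ^ (2 * (p' + 2)) * (κ ^ 2) ^ p' = 1 := by
      have : κ ^ 4 * κ⁻¹ ^ (2 * (p' + 2)) * (κ ^ 2) ^ p' = (κ * κ⁻¹) ^ (2 * (p' + 2)) := by ring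
      rw [this, mul_inv_cancel₀ hκne, one_pow]
    have h3 : (16 * e ^ 9 * κ ^ 2 * A * u) ^ p' = (16 * e ^ 9 * A * u) ^ p' * (κ ^ 2) ^ p' := by
      rw [← mul_pow]; congr 1; ring
    calc 2 ^ (p' + 2) * (4 * e ^ 9 * κ ^ 4 * κ⁻¹ ^ (2 * (p' + 2)) * t ^ (2 * (p' + 2)) * (16 * e ^ 9 * κ ^ 2 * A * u) ^ p' * u)
        = 2 ^ (p' + 2) * 4 * e ^ 9 * t ^ (2 * (p' + 2)) * (16 * e ^ 9 * A * u) ^ p' * u *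
            (κ ^ 4 * κ⁻¹ ^ (2 * (p' + 2)) * (κ ^ 2) ^ p') := by rw [h3]; ring
      _ = 2 ^ (p' + 2) * 4 * e ^ 9 * t ^ (2 * (p' + 2)) * (16 * e ^ 9 * A * u) ^ p' * u := by rw [hk, mul_one]
      _ = 16 * e ^ 9 * t ^ 4 * X ^ p' * u ^ (p' + 1) := by
          have e1 : (16 * e ^ 9 * A * u) ^ p' = 16 ^ p' * (e ^ 9) ^ p' * A ^ p' * u ^ p' := by rw [mul_pow, mul_pow, mul_pow]
          have e2 : X ^ p' = 32 ^ p' * (e ^ 9) ^ p' * (t ^ 2) ^ p' * A ^ p' := by rw [hX, mul_pow, mul_pow, mul_pow]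
          have e3 : (32 : ℝ) ^ p' = 2 ^ p' * 16 ^ p' := by rw [← mul_pow]; norm_num
          have e4 : t ^ (2 * (p' + 2)) = t ^ 4 * (t ^ 2) ^ p' := by rw [← pow_mul, ← pow_add]; congr 1; ring
          have e5 : (2 : ℝ) ^ (p' + 2) = 2 ^ p' * 4 := by rw [pow_add]; norm_num
          rw [e1, e2, e3, e4, e5, pow_succ]
          ring
  rw [hLHS]
  -- `16e⁹t⁴ ≤ X²`
  have h16 : 16 * e ^ 9 * t ^ 4 ≤ X ^ 2 := by
    rw [hX]
    have he9 : 1 ≤ e ^ 9 := one_le_pow₀ he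
    have hA2 : 1 ≤ A ^ 2 := one_le_pow₀ hA
    have ht4 : 0 ≤ t ^ 4 := by positivity
    have : 16 * e ^ 9 ≤ 1024 * (e ^ 9) ^ 2 * A ^ 2 := by nlinarith [he9, hA2]
    calc 16 * e ^ 9 * t ^ 4 ≤ 1024 * (e ^ 9) ^ 2 * A ^ 2 * t ^ 4 := by nlinarith [this, ht4]
      _ = (32 * e ^ 9 * t ^ 2 * A) ^ 2 := by ring
  have hKu : u ^ (p' + 1) ≤ (Klam * u) ^ (p' + 1) := by
    rw [mul_pow]
    exact le_mul_of_one_le_left (by positivity) (one_le_pow₀ hKlam)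
  calc 16 * e ^ 9 * t ^ 4 * X ^ p' * u ^ (p' + 1) ≤ X ^ 2 * X ^ p' * u ^ (p' + 1) := by
        have : 0 ≤ X ^ p' * u ^ (p' + 1) := by positivity
        nlinarith [h16, this]
    _ = X ^ (p' + 2) * u ^ (p' + 1) := by ring
    _ ≤ CE ^ (p' + 2) * u ^ (p' + 1) := mul_le_mul_of_nonneg_right (pow_le_pow_left₀ hX0 hCE _) (by positivity)
    _ ≤ CE ^ (p' + 2) * (Klam * u) ^ (p' + 1) := mul_le_mul_of_nonneg_left hKu (by positivity)

/-- **The carved (E1-W)₀ line at the budget `klWtBudget P Q U 0`, for EVERY `Q` with `32·e⁹·t²·klE4Abar R ≤ Q.CE`** (`t = 2·klIsoT + C_T + 8(klE4X0+1)`),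
under the doors `c ≤ klEngC₃3 P R ⊓ klE4C₃ R`, `U ≤ klEngU₀3 P R c ⊓ klE4U₀ R`, at every admissible frame `K`:
`KernelNormsWt4 L M (klWtBudget P Q U 0) β U μ K 0`. -/
theorem kernelNormsWt4_zero_klWtBudget_of_le_CE {C_T : ℝ} (hCT0 : 0 ≤ C_T)
    (hCT : ∀ (L M : ℕ) [NeZero L] [NeZero M] (R : RenConsts) (U : ℝ) (N : ℕ) (μ : ℝ) (K : TrigPolyC4v),
      FrameOK R U N μ K → (∀ j, 0 ≤ R.Gfr j) → μ ∈ klWindowC → 16 / 15 * (R.Gfr 0 * |U|) ≤ 1 / 50 → (2 : ℝ) ^ 15 ≤ L →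
      ∀ β : ℝ, klBetaMin ≤ β → β ≤ M → klE0 * β ≤ Real.pi * (2 * M - 13) →
      ∀ (ω : Fin (sectorCount 0)) (c : Fin 2),
        1 / (|β| * (L : ℝ) ^ 2) *
            ∑ dw : TorusSite 1 (2 * (2 * M)) × TorusSite 2 L,
              (β / (2 * (2 * M) : ℕ) * cyclicDist (2 * (2 * M)) (dw.1 0) 0) *
                ‖∑ k : FreqMomentum L M, klAnisoFamily L M β μ K klE0 0 ω k *
                  (if c = 0 then torusChar (fun _ : Fin 1 => ((k.1 : ℕ) : ZMod (2 * (2 * M)))) dw.1 * torusChar k.2 dw.2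
                    else conj (torusChar (fun _ : Fin 1 => ((k.1 : ℕ) : ZMod (2 * (2 * M)))) dw.1 * torusChar k.2 dw.2))‖ ≤
          C_T * (M / β))
    {Q : EngConsts} (P : SplitConsts) (R : RenConsts)
    (hCE : 32 * Real.exp 1 ^ 9 * (2 * klIsoT + C_T + 8 * (klE4X0 + 1)) ^ 2 * klE4Abar R ≤ Q.CE)
    (c : ℝ) (hP : P.WF) (hR : R.WF2) (hc : 0 < c) (hc₃ : c ≤ klEngC₃3 P R) (hcD : c ≤ klE4C₃ R)
    (μ : ℝ) (hμ : μ ∈ klWindowC) (U : ℝ) (hU : 0 < U) (hU₀ : U ≤ klEngU₀3 P R c) (hUD : U ≤ klE4U₀ R) (β : ℝ) (hβ : klBetaMin ≤ β)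
    (hβc : β ≤ Real.exp (c / U ^ 2)) (K : TrigPolyC4v) (hK : FrameOK R U (nScales β) μ K) (L M : ℕ) [NeZero L] [NeZero M]
    (hL : klEngL₃ β U ≤ L) (hM : klEngM₃ β U L ≤ M) :
    KernelNormsWt4 L M (klWtBudget P Q U 0) β U μ K 0 := by
  classical
  have hA1 : 1 ≤ klE4Abar R := one_le_klE4Abar R
  have hKlam : 1 ≤ P.Klam := hP.1
  have hCE0 : 0 ≤ Q.CE := le_trans (by positivity) hCE
  have he1 : 1 ≤ Real.exp 1 := Real.one_le_exp (by norm_num)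
  have hκ0 : 0 < Real.sqrt (2 * (7 + 6047)) := Real.sqrt_pos.2 (by norm_num)
  -- the auxiliary budget: the honest degree-2 size in slot 2, `klWtBudget … 0` elsewhere
  set B₂ : ℝ := 2 * (2 * klIsoT + C_T + 8 * (klE4X0 + 1)) ^ 2 *
      (Real.exp 1 ^ 5 * (klE4KapF R * |U| + 2 * (c / Real.log 4) * klE4Mom R) +
        4 * Real.exp 1 ^ 9 * Real.sqrt (2 * (7 + 6047)) ^ 2 * |U|) with hB₂
  set N' : ℕ → ℝ := fun m => if m = 2 then B₂ else klWtBudget P Q U 0 m with hN'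
  have hN'ne : ∀ m, m ≠ 2 → N' m = klWtBudget P Q U 0 m := fun m hm => by rw [hN']; exact if_neg hm
  have hNodd : ∀ m, Odd m → 0 ≤ N' m := by
    intro m hm
    have hm2 : m ≠ 2 := fun h => by rw [h] at hm; exact (Nat.not_odd_iff_even.2 (by decide)) hm
    rw [hN'ne m hm2]
    exact klWtBudget_nonneg hCE0 (zero_le_one.trans hKlam) U 0 m
  have hN2 : B₂ ≤ N' 2 := by rw [hN']; exact le_of_eq (if_pos rfl).symm
  have hNp : ∀ p, 2 ≤ p → 2 ^ p * (4 * Real.exp 1 ^ 9 * Real.sqrt (2 * (7 + 6047)) ^ 4 * (Real.sqrt (2 * (7 + 6047)))⁻¹ ^ (2 * p) *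
      (2 * klIsoT + C_T + 8 * (klE4X0 + 1)) ^ (2 * p) *
        (16 * Real.exp 1 ^ 9 * Real.sqrt (2 * (7 + 6047)) ^ 2 * klE4Abar R * |U|) ^ (p - 2) * |U|) ≤ N' (2 * p) := by
    intro p hp
    obtain ⟨p', rfl⟩ : ∃ p', p = p' + 2 := ⟨p - 2, by omega⟩
    rw [hN'ne (2 * (p' + 2)) (by omega), klWtBudget_two_mul_of_two_le P Q U 0 hp, show p' + 2 - 2 = p' from rfl,
      show p' + 2 - 1 = p' + 1 from rfl]
    have hε : epsCoupling P U 0 = P.Klam * |U| := by rw [epsCoupling]; push_cast; ring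
    rw [hε, show ((3 * ((p' + 2 : ℕ) : ℤ) - 5) * ((0 : ℕ) : ℤ)) = 0 by push_cast; ring, zpow_zero, mul_one]
    exact wtBudget_dominates_biGraded he1 hκ0 hA1 (abs_nonneg U) hKlam hCE p'
  have hWt : KernelNormsWt L M N' β U μ K 0 :=
    kernelNormsWt_zero_of_doors hCT0 hCT P R c hP hR hc hc₃ hcD μ hμ U hU hU₀ hUD β hβ hβc K hK L M hL hM N' hNodd hN2 hNp
  refine kernelNormsWt4_of_forall_ne_two fun m hm q w => ?_
  rw [← hN'ne m hm]
  exact hWt m q w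

/-! ## §3 At the registration thresholds; the `∃ T` form -/

/-- **The carved (E1-W)₀ line at the REGISTRATION thresholds** `c ≤ klEngC₃6 P R`, `U ≤ klEngU₀6 P R c` (one `le_trans` per door), every `Q`
with `32·e⁹·t²·klE4Abar R ≤ Q.CE`, every admissible frame `K` (in the flow child: `K = K_n`). -/
theorem kernelNormsWt4_zero_klWtBudget_klEng6_of_le_CE {C_T : ℝ} (hCT0 : 0 ≤ C_T)
    (hCT : ∀ (L M : ℕ) [NeZero L] [NeZero M] (R : RenConsts) (U : ℝ) (N : ℕ) (μ : ℝ) (K : TrigPolyC4v),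
      FrameOK R U N μ K → (∀ j, 0 ≤ R.Gfr j) → μ ∈ klWindowC → 16 / 15 * (R.Gfr 0 * |U|) ≤ 1 / 50 → (2 : ℝ) ^ 15 ≤ L →
      ∀ β : ℝ, klBetaMin ≤ β → β ≤ M → klE0 * β ≤ Real.pi * (2 * M - 13) →
      ∀ (ω : Fin (sectorCount 0)) (c : Fin 2),
        1 / (|β| * (L : ℝ) ^ 2) *
            ∑ dw : TorusSite 1 (2 * (2 * M)) × TorusSite 2 L,
              (β / (2 * (2 * M) : ℕ) * cyclicDist (2 * (2 * M)) (dw.1 0) 0) *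
                ‖∑ k : FreqMomentum L M, klAnisoFamily L M β μ K klE0 0 ω k *
                  (if c = 0 then torusChar (fun _ : Fin 1 => ((k.1 : ℕ) : ZMod (2 * (2 * M)))) dw.1 * torusChar k.2 dw.2
                    else conj (torusChar (fun _ : Fin 1 => ((k.1 : ℕ) : ZMod (2 * (2 * M)))) dw.1 * torusChar k.2 dw.2))‖ ≤
          C_T * (M / β))
    {Q : EngConsts} (P : SplitConsts) (R : RenConsts)
    (hCE : 32 * Real.exp 1 ^ 9 * (2 * klIsoT + C_T + 8 * (klE4X0 + 1)) ^ 2 * klE4Abar R ≤ Q.CE)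
    (c : ℝ) (hP : P.WF) (hR : R.WF2) (hc : 0 < c) (hc₆ : c ≤ klEngC₃6 P R)
    (μ : ℝ) (hμ : μ ∈ klWindowC) (U : ℝ) (hU : 0 < U) (hU₆ : U ≤ klEngU₀6 P R c) (β : ℝ) (hβ : klBetaMin ≤ β)
    (hβc : β ≤ Real.exp (c / U ^ 2)) (K : TrigPolyC4v) (hK : FrameOK R U (nScales β) μ K) (L M : ℕ) [NeZero L] [NeZero M]
    (hL : klEngL₃ β U ≤ L) (hM : klEngM₃ β U L ≤ M) :
    KernelNormsWt4 L M (klWtBudget P Q U 0) β U μ K 0 :=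
  kernelNormsWt4_zero_klWtBudget_of_le_CE hCT0 hCT P R hCE c hP hR hc (hc₆.trans (klEngC₃6_le_klEngC₃3 P R))
    (hc₆.trans (klEngC₃6_le_klE4C₃ P R)) μ hμ U hU (hU₆.trans (klEngU₀6_le_klEngU₀3 P R c)) (hU₆.trans (klEngU₀6_le_klE4U₀ P R c))
    β hβ hβc K hK L M hL hM

/-- **`∃ T ≥ 0` form, `T` INDEPENDENT of `P`, `R`, `Q`** (the input of a `Q`-side package raise `CE := max … (32e⁹·T²·klE4Abar R)`, #7 pattern):
there is `T ≥ 0` such that for every `P`, `R`, every `Q` with `32·e⁹·T²·klE4Abar R ≤ Q.CE`, under the binders of stub (b) at the registration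
thresholds (`klEngC₃6`, `klEngU₀6`) and every admissible frame `K`, `KernelNormsWt4 L M (klWtBudget P Q U 0) β U μ K 0`.
(`T := 2·klIsoT + C_T + 8(klE4X0 + 1)` with p4 g8's time-moment witness `C_T`.) -/
theorem exists_kernelNormsWt4_zero_klWtBudget_klEng6 :
    ∃ T : ℝ, 0 ≤ T ∧ ∀ (P : SplitConsts) (R : RenConsts) (Q : EngConsts) (c : ℝ), P.WF → R.WF2 →
      32 * Real.exp 1 ^ 9 * T ^ 2 * klE4Abar R ≤ Q.CE → 0 < c → c ≤ klEngC₃6 P R →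
      ∀ μ ∈ klWindowC, ∀ U : ℝ, 0 < U → U ≤ klEngU₀6 P R c →
      ∀ β : ℝ, klBetaMin ≤ β → β ≤ Real.exp (c / U ^ 2) → ∀ K : TrigPolyC4v, FrameOK R U (nScales β) μ K →
      ∀ (L M : ℕ) [NeZero L] [NeZero M], klEngL₃ β U ≤ L → klEngM₃ β U L ≤ M →
        KernelNormsWt4 L M (klWtBudget P Q U 0) β U μ K 0 := by
  obtain ⟨C_T, hCT0, hCT⟩ := exists_timeMomentConst_klAnisoFamily_zero
  have hX0 : 0 ≤ klE4X0 := uvSpaceMomentConst_nonneg _ _ _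
  refine ⟨2 * klIsoT + C_T + 8 * (klE4X0 + 1), by have := klIsoT_nonneg; positivity, ?_⟩
  intro P R Q c hP hR hCE hc hc₆ μ hμ U hU hU₆ β hβ hβc K hK L M _ _ hL hM
  exact kernelNormsWt4_zero_klWtBudget_klEng6_of_le_CE hCT0 hCT P R hCE c hP hR hc hc₆ μ hμ U hU hU₆ β hβ hβc K hK L M hL hM

end Summit.HubbardSuperconductivity.HubbardSuperconductivity.Theorems.EngineV8

end
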